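import Literature.Computability.QuantumComplexity.F2PolynomialFourierTailsLevelKProofs
import Literature.Computability.Complexity.HadamardPCP
import HarnessLib

/-!
# The polar form of a quadratic `𝔽₂`-valued function, and the bridge from Boolean data

Topic `Literature/Computability/QuantumComplexity` (written for the dequantizer of cubic 2-fold
Forrelation, route `QuantumAdvantage/CubicForrelation`, on top of the tree's derivative calculus of
`F2PolynomialFourierTailsLevelKProofs.lean`: `CHHL2018.der a G (x) = G(x ⊕ a) + G(x)`,
`CHHL2018.lowDeg n d` = functions all of whose `(d+1)`-fold derivatives vanish, the bridge
`CHHL2018.eval_mem_lowDeg` from `MvPolynomial`s of total degree `≤ d`).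

For `Q : {0,1}ⁿ → 𝔽₂` the **polar form** is `B_Q(x,y) = Q(x ⊕ y) + Q(x) + Q(y) + Q(0)`
(MacWilliams–Sloane Ch. 15 §2; Carlet 2020 §5.2, the "associated symplectic form"). This file
proves what the exact Fourier sampler of quadratic phase functions uses:

* `polar_comm`, `polar_self`, `polar_zero_right` (symmetric, alternating), and the identity
  `polar_add_left_defect`: the additivity defect `B(x⊕x',y)+B(x,y)+B(x',y)` is the third derivative
  `D_x D_{x'} D_y Q (0)`; hence for `Q ∈ lowDeg n 2` the polar form is additive in each argument
  (`polar_add_left`, `polar_add_right` — bilinear over `𝔽₂`), and `Q(x⊕d)+Q(x) = B(x,d)+Q(d)+Q(0)`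
  (`shift_add_eq_polar`);
* Boolean data: `toZFun f = toZ ∘ f` (the tree's `BLR.toZ`), `toZFun_xor_xorVec` (the Boolean
  derivative `f ⊕ f(· ⊕ h)` reads as `der h`), and `toZFun_mem_lowDeg_of_poly`: a function
  represented on the cube by a polynomial of total degree `≤ d` — the shape of
  `IsDegLeFun d` in `CubicForrelation.lean` — lies in `lowDeg n d`; so the derivative of a cubic is
  in `lowDeg n 2` (`der_toZFun_mem_lowDeg_two_of_cubic`).

## References

* F. J. MacWilliams, N. J. A. Sloane, *The Theory of Error-Correcting Codes*, 1977, Ch. 15 §2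
  (quadratic forms over `GF(2)`, the associated alternating bilinear form). [MacWilliamsSloane1977]
* C. Carlet, *Boolean Functions for Cryptography and Coding Theory*, CUP 2020, §2.2.2 (derivatives
  lower the algebraic degree), §5.2 (quadratic functions). [Carlet2020]
-/

namespace Literature.Computability.QuantumComplexity

namespace QuadPolar

open Finset CHHL2018
open Literature.Computability.Complexity.LowDegree (xorVec xorVec_apply xorVec_xorVec_cancel)
open Literature.Computability.Complexity.BLR (toZ toZ_xor toZ_injective)
open Literature.Computability.Complexity (Multilinear.boolPt)

variable {n : ℕ}

/-! ### Small algebra of `xorVec` -/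

/-- `x ⊕ y = y ⊕ x`. [folklore] -/
theorem xorVec_comm (x y : Fin n → Bool) : xorVec x y = xorVec y x := by
  funext i; simp [Bool.xor_comm]

/-- `x ⊕ x = 0`. [folklore] -/
@[simp] theorem xorVec_self (x : Fin n → Bool) : xorVec x x = fun _ => false := by
  funext i; simp

/-- `x ⊕ 0 = x`. [folklore] -/
@[simp] theorem xorVec_zero_right (x : Fin n → Bool) : xorVec x (fun _ => false) = x := by
  funext i; simp

/-- `0 ⊕ x = x`. [folklore] -/
@[simp] theorem xorVec_zero_left (x : Fin n → Bool) : xorVec (fun _ => false) x = x := by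
  funext i; simp

/-- `2 = 0` in `𝔽₂`. [folklore] -/
theorem two_eq_zero : (2 : ZMod 2) = 0 := rfl

/-! ### The polar form -/

/-- The polar form `B_Q(x, y) = Q(x ⊕ y) + Q(x) + Q(y) + Q(0)`. [cite: MacWilliamsSloane1977, Ch. 15 §2] -/
def polar (Q : (Fin n → Bool) → ZMod 2) (x y : Fin n → Bool) : ZMod 2 := Q (xorVec x y) + Q x + Q y + Q (fun _ => false)

/-- The polar form is symmetric. [cite: MacWilliamsSloane1977, Ch. 15 §2] -/
theorem polar_comm (Q : (Fin n → Bool) → ZMod 2) (x y : Fin n → Bool) : polar Q x y = polar Q y x := by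
  unfold polar; rw [xorVec_comm]; ring

/-- The polar form is alternating. [cite: MacWilliamsSloane1977, Ch. 15 §2] -/
theorem polar_self (Q : (Fin n → Bool) → ZMod 2) (x : Fin n → Bool) : polar Q x x = 0 := by
  unfold polar; rw [xorVec_self]
  linear_combination (Q x + Q (fun _ => false)) * two_eq_zero

/-- The polar form vanishes against `0`. [folklore] -/
theorem polar_zero_right (Q : (Fin n → Bool) → ZMod 2) (x : Fin n → Bool) : polar Q x (fun _ => false) = 0 := by
  unfold polar; rw [xorVec_zero_right]
  linear_combination (Q x + Q (fun _ => false)) * two_eq_zero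

/-- **The additivity defect of the polar form is a third derivative at `0`.** [cite: Carlet2020, §2.2.2] -/
theorem polar_add_left_defect (Q : (Fin n → Bool) → ZMod 2) (x x' y : Fin n → Bool) :
    polar Q (xorVec x x') y + polar Q x y + polar Q x' y = der x (der x' (der y Q)) (fun _ => false) := by
  simp only [polar, der_apply, xorVec_zero_left]
  linear_combination (Q y + Q (fun _ => false)) * two_eq_zero

/-- Three derivatives kill a function of degree `≤ 2`. [cite: Carlet2020, §2.2.2] -/
theorem der_der_der_eq_zero {Q : (Fin n → Bool) → ZMod 2} (hQ : Q ∈ lowDeg n 2) (a b c : Fin n → Bool) :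
    der a (der b (der c Q)) = 0 :=
  der_eq_zero_of_mem_lowDeg_zero (mem_lowDeg_succ.1 (mem_lowDeg_succ.1 hQ c) b) a

/-- **For a quadratic function the polar form is additive on the left** (bilinear over `𝔽₂`).
[cite: MacWilliamsSloane1977, Ch. 15 §2] -/
theorem polar_add_left {Q : (Fin n → Bool) → ZMod 2} (hQ : Q ∈ lowDeg n 2) (x x' y : Fin n → Bool) :
    polar Q (xorVec x x') y = polar Q x y + polar Q x' y := by
  have h := polar_add_left_defect Q x x' y
  rw [der_der_der_eq_zero hQ, Pi.zero_apply] at h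
  linear_combination h - (polar Q x y + polar Q x' y) * two_eq_zero

/-- … and on the right. [cite: MacWilliamsSloane1977, Ch. 15 §2] -/
theorem polar_add_right {Q : (Fin n → Bool) → ZMod 2} (hQ : Q ∈ lowDeg n 2) (x y y' : Fin n → Bool) :
    polar Q x (xorVec y y') = polar Q x y + polar Q x y' := by
  rw [polar_comm, polar_add_left hQ, polar_comm Q y, polar_comm Q y']

/-- **The shift through the polar form**: `Q(x ⊕ d) + Q(x) = B_Q(x,d) + Q(d) + Q(0)`.
[cite: MacWilliamsSloane1977, Ch. 15 §2] -/
theorem shift_add_eq_polar (Q : (Fin n → Bool) → ZMod 2) (x d : Fin n → Bool) :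
    Q (xorVec x d) + Q x = polar Q x d + Q d + Q (fun _ => false) := by
  unfold polar
  linear_combination (-(Q d + Q (fun _ => false))) * two_eq_zero

/-! ### Boolean data -/

/-- A Boolean function read in `𝔽₂` (through the tree's `BLR.toZ`). [folklore] -/
def toZFun (f : (Fin n → Bool) → Bool) : (Fin n → Bool) → ZMod 2 := fun x => toZ (f x)

/-- Unfolding `toZFun`. [folklore] -/
@[simp] theorem toZFun_apply (f : (Fin n → Bool) → Bool) (x : Fin n → Bool) : toZFun f x = toZ (f x) := rfl

/-- Reading `[z = 1]` back in `𝔽₂` gives `z`. [folklore] -/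
theorem toZ_decide_eq_one (z : ZMod 2) : toZ (decide (z = 1)) = z := by
  fin_cases z <;> rfl

/-- **The Boolean derivative reads as `der`**: `[f(x) ⊕ f(x ⊕ h)] = D_h [f] (x)`. [cite: Carlet2020, §2.2.2] -/
theorem toZFun_xor_xorVec (f : (Fin n → Bool) → Bool) (h : Fin n → Bool) :
    toZFun (fun x => (f x ^^ f (xorVec x h))) = der h (toZFun f) := by
  funext x; simp [toZFun, toZ_xor, add_comm]

/-- **Bridge from polynomial representations**: if `f x = [p(x) = 1]` on the cube for a polynomial of
total degree `≤ d` over `𝔽₂` (the shape of `IsDegLeFun d f`), then `[f] ∈ lowDeg n d`.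
[cite: Carlet2020, §2.2.1] -/
theorem toZFun_mem_lowDeg_of_poly {d : ℕ} {f : (Fin n → Bool) → Bool} (p : MvPolynomial (Fin n) (ZMod 2))
    (hp : p.totalDegree ≤ d)
    (hf : ∀ x, f x = decide (MvPolynomial.eval (fun j => if x j then (1 : ZMod 2) else 0) p = 1)) :
    toZFun f ∈ lowDeg n d := by
  have e : toZFun f = fun x => MvPolynomial.eval (Multilinear.boolPt x) p := by
    funext x; rw [toZFun_apply, hf x, toZ_decide_eq_one]; rfl
  rw [e]; exact eval_mem_lowDeg p hp

/-- **The derivative of a cubic is quadratic**: for `f` of degree `≤ 3` (polynomial form), every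
Boolean derivative `x ↦ f(x) ⊕ f(x ⊕ h)` reads in `lowDeg n 2`. [cite: Carlet2020, §2.2.2] -/
theorem der_toZFun_mem_lowDeg_two_of_cubic {f : (Fin n → Bool) → Bool} (p : MvPolynomial (Fin n) (ZMod 2))
    (hp : p.totalDegree ≤ 3)
    (hf : ∀ x, f x = decide (MvPolynomial.eval (fun j => if x j then (1 : ZMod 2) else 0) p = 1))
    (h : Fin n → Bool) : toZFun (fun x => (f x ^^ f (xorVec x h))) ∈ lowDeg n 2 := by
  rw [toZFun_xor_xorVec]
  exact mem_lowDeg_succ.1 (toZFun_mem_lowDeg_of_poly p hp hf) h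

end QuadPolar

end Literature.Computability.QuantumComplexity
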